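import Summits.QuantumFields.YangMills.Theorems.FluctuationComparisonRegPrIntLHaarTubeNoMargin
import Summits.QuantumFields.YangMills.Theorems.FluctuationComparisonRegPrIntLPersistenceFromHeightwiseBounds
import Summits.QuantumFields.YangMills.Theorems.FluctuationComparisonRegPrIntLFibreTubeVolume
import HarnessLib

/-!
# `FluctuationComparisonRegPrIntLTubeFromThm1` — TUBE∘ `SectionTubeMassIntCan` ⟸ BAŁABAN's TWO K-UNIFORM HEIGHTWISE DENSITY BOUNDS AND NOTHING ELSE
# (the TUBE∘ twin of LEAD w3-20520 g18's PERS-FINAL-KNIT `…PersistenceFromThm1`; crux `FluctuationComparisonRegPrIntL`, stmt-QuantumFields-20520;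
# LINE g22-4 ∕ g22-6 row TUBE∘)

Cell `ym3-torus` (YM ladder rung R3 = continuum SU(2) Yang–Mills on T³ — a RUNG, NOT d = 4, NOT infinite volume, NOT a mass gap, NOT Clay);
width seat `ym-ust-20520-w4` (gen 18), explicit-unit helper; `--supports stmt-QuantumFields-20520 --as helper`.  THEOREMS ONLY (0 `def`, 0 `sorry`,
default heartbeats).

WHAT.  ✓`…HaarTubeNoMargin.sectionTubeMassIntCan_of_up_low` (w4) reduced TUBE∘ to the two K-UNIFORM letters ⟨UP⟩ (the run-`K` law of level `J+1` dominated by product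
Haar over the interior window) and ⟨LOW(2θ)⟩ (it dominates a multiple of product Haar on `{PlaqSmall 2θ_{J+1}(b₀)}`); LEAD w3-20520 g18's ✓`…PersistenceFromHeightwiseBounds`
named those letters against the tree's typed Literature — ⟨UP⟩ ⟸ lit `T3HeightwiseDensityBounds.HeightwiseUpperBound F γ` ([Balaban1985UV3] (5) upper over (6), read
heightwise, K-uniform: ✓`up_of_heightwiseUpperBound`), ⟨LOW on S⟩ ⟸ an a.e. lower bound of the QUOTIENT density `Z_K⁻¹·heightDensity` on `S` (✓`low_of_heightwiseLowerDensity`).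
THIS FILE composes the two: ★★★★ `sectionTubeMassIntCan_of_heightwiseBounds` — in TUBE∘'s prefix, after `F, γ`: `HeightwiseUpperBound F γ` and, for every `J`, ONE `cl > 0`
with `cl ≤ Z_K⁻¹·heightDensity F γ (J+1 ≤ K) univ V` for `dU_{J+1}`-a.e. `V` with `PlaqSmall (2θ_{J+1}(b₀)) V`, all `K ≥ J+1` ⟹ TUBE∘ `SectionTubeMassIntCan` VERBATIM — the
hypothesis is LEAD's PERS-FINAL-KNIT hypothesis with the level-`(J+1)` INTERIOR window `{PlaqSmall θ_{J+1}(c·b₀)}` replaced by the DOUBLED window `{PlaqSmall 2θ_{J+1}(b₀)}`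
(TUBE∘'s sections have no margin, so the tube reaches `2θ`; `γ₁` is clipped to `min γ₁ 1` inside).  So TUBE∘ and PERS₁∘ now rest BY NAME on the SAME two schemas of
[Balaban1985UV3] Thm 1 (5)∕(6) for the pinned `ℰp` densities — the cell's construction statement, XL, nobody's; every K-free ingredient is consumed by kernel
(px20 g11 local charge ∕ depth-one floor, px8 g14 chart door, w4 l.s.c. engine ∕ no-margin tube, LEAD split ∕ heightwise letters).

* §2 ★★★★ `fibreTubeVolumeCan` — **FV∘ `FibreTubeVolumeCan` of LINE g22-6 `tube_harnack` UNCONDITIONALLY** (row text VERBATIM, hypothesis-free): px20 g11's door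
  ✓`…FibreTubeVolume.fibreTubeVolumeCan_of_haarTube` applied to w4's theorem ✓`…HaarTubeNoMargin.haarTube_noMargin_depthOne` (px20 g11 07:47:41Z: «the 3-line
  hypothesis-free `fibreTubeVolumeCan` is w4's to place»); by the line's junction `sectionTubeMass_of_harnack_volume` TUBE∘ then ⟸ FH∘ alone as well.

HONEST SCOPE.  A knit; Thm 1 ∕ (5) ∕ (6), ⟨UP⟩, ⟨LOW⟩, TUBE∘ (hence FH∘-free TUBE∘), PERS₁∘, PLAQTAIL∘, LFR♯ᶜ∘, S2β, the crux 20520 and every rung statement are NOT proved;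
`YM3TorusSU2` NOT proved; the Yang–Mills mass gap (Clay) NOT proved.

References: T. Bałaban, Commun. Math. Phys. **102** (1985) 255–275 [Balaban1985UV3] ((5)–(7) pp. 256–257, Thm 1 p. 257, (38)–(41) p. 266); CMP **98** (1985) 17–51
[Balaban1985Averaging] ((10) p. 19, Prop. 1 p. 22); CMP **109** (1987) 249–301 [Balaban1987RG1] ((0.18)–(0.22) p. 255).
-/

set_option autoImplicit false

noncomputable section

open MeasureTheory Filter Topology Set
open scoped ENNReal NNReal
open Literature.MathematicalPhysics.QuantumFieldTheory.Balaban1983to89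
open Literature.MathematicalPhysics.QuantumFieldTheory.Balaban1983to89.T3ContinuumYM3Torus
open Literature.MathematicalPhysics.QuantumFieldTheory.Balaban1983to89.T3NestedUnitLaws
open Literature.MathematicalPhysics.QuantumFieldTheory.Balaban1983to89.T3UnitLawDensityEML
open Literature.MathematicalPhysics.QuantumFieldTheory.Balaban1983to89.T3UnitScaleTilt
open Literature.MathematicalPhysics.QuantumFieldTheory.Balaban1983to89.T3TiltDescent
open Literature.MathematicalPhysics.QuantumFieldTheory.Balaban1983to89.T3HeightwiseDensityBounds
open Literature.MathematicalPhysics.QuantumFieldTheory.Balaban1983to89.Missing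
open Literature.MathematicalPhysics.QuantumFieldTheory.Balaban1983to89.T4Continuum
open Summit.QuantumFields.YangMills.Theorems.FluctuationComparisonRegPrIntLPersistenceFromHeightwiseBounds
open Summit.QuantumFields.YangMills.Theorems.FluctuationComparisonRegPrIntLHaarTubeNoMargin (sectionTubeMassIntCan_of_up_low haarTube_noMargin_depthOne)
open Summit.QuantumFields.YangMills.Theorems.FluctuationComparisonRegPrIntLFibreTubeVolume (fibreTubeVolumeCan_of_haarTube)
open ProbabilityTheory
open Literature.MathematicalPhysics.QuantumFieldTheory.Balaban1983to89.T4AveragingDisintegration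

namespace Summit.QuantumFields.YangMills.Theorems.FluctuationComparisonRegPrIntLTubeFromThm1

/-- ★★★★ **TUBE∘ `SectionTubeMassIntCan` FROM BAŁABAN'S HEIGHTWISE (5)∕(6) ALONE.**  Hypothesis (TUBE∘'s prefix; then, after `F, γ`): the K-uniform heightwise UPPER
schema lit `HeightwiseUpperBound F γ` and, for every window level `J`, ONE `cl > 0` bounding the quotient density `Z_K⁻¹·heightDensity F γ (J+1 ≤ K) univ` from BELOW
`dU_{J+1}`-a.e. on the doubled small class `{PlaqSmall 2θ_{J+1}(b₀)}`, for every run `K ≥ J+1`.  Conclusion: TUBE∘ — the text of `Lines/persistence_geometry.lean` row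
`SectionTubeMassIntCan`, VERBATIM.  Proof: ✓`up_of_heightwiseUpperBound` ∕ ✓`low_of_heightwiseLowerDensity` (LEAD) feed ✓`sectionTubeMassIntCan_of_up_low` (w4), with
`γ₁ ↦ min γ₁ 1`.  The two letters are [Balaban1985UV3] Thm 1's content for the pinned `ℰp` densities — DISPLAYED, NOT proved here.
[cite: Balaban1985UV3, (5)-(7) pp.256-257 and Thm 1 p.257 and (38)-(41) p.266; Balaban1985Averaging, Prop. 1 p.22; Balaban1987RG1, (0.18)-(0.22) p.255] -/
theorem sectionTubeMassIntCan_of_heightwiseBounds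
    (h : ∀ (L : ℕ), ∃ c₀ : ℝ, 0 < c₀ ∧ c₀ ≤ 1 ∧ ∀ (c : ℝ), 0 < c → c ≤ c₀ → ∃ pS : ℝ, ∀ (b₀ p₀ : ℝ), 0 < b₀ → pS ≤ p₀ → 0 < p₀ →
      ∃ γ₁ : ℝ, 0 < γ₁ ∧ ∀ (F : T3Family) (γ : ℝ), F.L = L → 0 < γ → γ ≤ γ₁ →
        HeightwiseUpperBound F γ ∧
        ∀ (J : ℕ), ∃ cl : ℝ, 0 < cl ∧ ∀ (K : ℕ) (hJK : J + 1 ≤ K),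
          ∀ᵐ V ∂(fieldMeasure (F.P (J + 1)) 0 (Matrix.specialUnitaryGroup (Fin 2) ℂ)), PlaqSmall (2 * θBal F.L γ b₀ p₀ (J + 1)) V →
            cl ≤ (partitionFn (G := Matrix.specialUnitaryGroup (Fin 2) ℂ) (F.P K) ((F.scheme ℰp γ).β K))⁻¹ * heightDensity F γ hJK Set.univ V) :
    ∀ (L : ℕ), ∃ c₀ : ℝ, 0 < c₀ ∧ c₀ ≤ 1 ∧ ∀ (c : ℝ), 0 < c → c ≤ c₀ → ∃ pS : ℝ, ∀ (b₀ p₀ : ℝ), 0 < b₀ → pS ≤ p₀ → 0 < p₀ →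
      ∃ γ₁ : ℝ, 0 < γ₁ ∧ ∀ (F : T3Family) (γ : ℝ), F.L = L → 0 < γ → γ ≤ γ₁ →
        ∀ (J : ℕ) (r : ℝ), 0 < r →
          ∀ σ : GaugeField (F.P J) 0 (Matrix.specialUnitaryGroup (Fin 2) ℂ) → GaugeField (F.P (J + 1)) 0 (Matrix.specialUnitaryGroup (Fin 2) ℂ), Measurable σ →
            (∀ U : GaugeField (F.P J) 0 (Matrix.specialUnitaryGroup (Fin 2) ℂ), PlaqSmall (θBal F.L γ (c * b₀) p₀ J) U →
              descendTo F ℰp J (J + 1) (Nat.le_succ J) (σ U) = U ∧ PlaqSmall (θBal F.L γ b₀ p₀ (J + 1)) (σ U)) →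
            ∃ q : ℝ, 0 < q ∧ ∀ (K : ℕ) (hJK : J + 1 ≤ K)
              (B : Set (GaugeField (F.P J) 0 (Matrix.specialUnitaryGroup (Fin 2) ℂ))), MeasurableSet B →
                B ⊆ {U | PlaqSmall (θBal F.L γ (c * b₀) p₀ J) U} →
                ENNReal.ofReal q * gibbsK F ℰp γ K (descendTo F ℰp J K ((Nat.le_succ J).trans hJK) ⁻¹' B) ≤
                  gibbsK F ℰp γ K (descendTo F ℰp J K ((Nat.le_succ J).trans hJK) ⁻¹' B ∩
                    {V | ∀ b : PBond (F.P (J + 1)) 0,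
                      dist1 ((σ (descendTo F ℰp J K ((Nat.le_succ J).trans hJK) V) b)⁻¹ *
                        descendTo F ℰp (J + 1) K hJK V b) < r}) := by
  refine sectionTubeMassIntCan_of_up_low fun L => ?_
  obtain ⟨c₀, hc₀, hc₀1, hc⟩ := h L
  refine ⟨c₀, hc₀, hc₀1, fun c hcpos hcle => ?_⟩
  obtain ⟨pS, hpS⟩ := hc c hcpos hcle
  refine ⟨pS, fun b₀ p₀ hb₀ hpS' hp₀ => ?_⟩
  obtain ⟨γ₁, hγ₁, hγ₁F⟩ := hpS b₀ p₀ hb₀ hpS' hp₀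
  refine ⟨min γ₁ 1, lt_min hγ₁ one_pos, min_le_right _ _, fun F γ hFL hγ hγle J => ?_⟩
  obtain ⟨hup, hJ⟩ := hγ₁F F γ hFL hγ (hγle.trans (min_le_left _ _))
  obtain ⟨cl, hcl, hlow⟩ := hJ J
  obtain ⟨C, hC, hUP⟩ := up_of_heightwiseUpperBound F hγ.le hup J
  exact ⟨C, cl, hC, hcl, fun K hJK => ⟨hUP K hJK _,
    low_of_heightwiseLowerDensity F hγ.le hJK (measurableSet_plaqSmall _) (hlow K hJK)⟩⟩

/-! ## §2 FV∘ of LINE g22-6 unconditionally -/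

/-- ★★★★ **FV∘ · K-FREE VOLUME FLOOR OF SMALL-FIELD LINK-TUBES UNDER THE CONDITIONAL HAAR LAW OF THE ONE-STEP FIBRE — A THEOREM** (`FibreTubeVolumeCan` of
`Cruxes/FluctuationComparisonRegPrIntL/Lines/tube_harnack.lean`, text VERBATIM, NO hypothesis): for every measurable admissible section `σ` and radius `r > 0` ONE `v > 0`
bounds from below, for `(dU_{J+1}.map D_{J,J+1})`-a.e. interior datum `U`, the conditional Haar mass `condLaw dU_{J+1} D_{J,J+1} U` of `tube_r(σ U) ∩ {PlaqSmall 2θ_{J+1}(b₀)}`.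
= px20 g11's ✓`fibreTubeVolumeCan_of_haarTube` ∘ w4's ✓`haarTube_noMargin_depthOne` — the [Balaban1985Averaging] Prop. 1-type regularity of the one-step averaging on regular
configurations, read through the WREG charts with local charge (px20), the l.s.c.-floor engine (w4), the chart door (px8) and the depth-one Haar floor (px20); no coarea formula.
[cite: Balaban1985Averaging, (10) p.19 and Prop. 1 p.22; Balaban1987RG1, (0.4) p.253 and (0.11) p.253 and (2.10) p.267; Balaban1985UV3, (7) p.257] -/
theorem fibreTubeVolumeCan :
    ∀ (L : ℕ), ∃ c₀ : ℝ, 0 < c₀ ∧ c₀ ≤ 1 ∧ ∀ (c : ℝ), 0 < c → c ≤ c₀ → ∃ pS : ℝ, ∀ (b₀ p₀ : ℝ), 0 < b₀ → pS ≤ p₀ → 0 < p₀ →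
    ∃ γ₁ : ℝ, 0 < γ₁ ∧ ∀ (F : T3Family) (γ : ℝ), F.L = L → 0 < γ → γ ≤ γ₁ →
      ∀ (J : ℕ) (r : ℝ), 0 < r →
        ∀ σ : GaugeField (F.P J) 0 (Matrix.specialUnitaryGroup (Fin 2) ℂ) → GaugeField (F.P (J + 1)) 0 (Matrix.specialUnitaryGroup (Fin 2) ℂ), Measurable σ →
          (∀ U : GaugeField (F.P J) 0 (Matrix.specialUnitaryGroup (Fin 2) ℂ), PlaqSmall (θBal F.L γ (c * b₀) p₀ J) U →
            descendTo F ℰp J (J + 1) (Nat.le_succ J) (σ U) = U ∧ PlaqSmall (θBal F.L γ b₀ p₀ (J + 1)) (σ U)) →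
          ∃ v : ℝ, 0 < v ∧
            ∀ᵐ U ∂((fieldMeasure (F.P (J + 1)) 0 (Matrix.specialUnitaryGroup (Fin 2) ℂ)).map (descendTo F ℰp J (J + 1) (Nat.le_succ J))),
              PlaqSmall (θBal F.L γ (c * b₀) p₀ J) U →
                ENNReal.ofReal v ≤
                  (condLaw (fieldMeasure (F.P (J + 1)) 0 (Matrix.specialUnitaryGroup (Fin 2) ℂ)) (descendTo F ℰp J (J + 1) (Nat.le_succ J)) U)
                    {W | (∀ b : PBond (F.P (J + 1)) 0, dist1 ((σ U b)⁻¹ * W b) < r) ∧ PlaqSmall (2 * θBal F.L γ b₀ p₀ (J + 1)) W} :=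
  fibreTubeVolumeCan_of_haarTube haarTube_noMargin_depthOne

end Summit.QuantumFields.YangMills.Theorems.FluctuationComparisonRegPrIntLTubeFromThm1

end
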